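import Summits.NavierStokesRegularity.NavierStokesRegularity.Theorems.SoloRefuteShahmurov2026Prop52ConcretePair

/-!
# D-0090 NS-CLAIMS, claim C11 `Shahmurov2026` (T = arXiv:2605.09797 v2), row #11 — BY-SLOT record:
# the charitable concrete face `Prop52Concrete` of Proposition 5.2 is false as typed, by a saturating-shape
# pair IN THE PAPER'S OWN LIFTED CLASS

Records-grade, by-slot of #11 only (chair RULINGS 2026-08-27T08:12Z (1): YES on referee lane 3's three
conditions 08:09:13Z). The verdict of record for #11 is UNCHANGED by this file: first failing step =
`Literature.Claims.NS.Shahmurov2026.Prop52` = Prop 5.2 p.14–15 (stationarity premise / interface with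
Prop 5.1), class = unfilled gap; load-bearing Thm 5.4 p.15; token / locator / totals untouched.

## What is proved (0 sorry, axioms `propext · Classical.choice · Quot.sound`)

* `Shahmurov2026.Prop52Concrete` — the face, a local `def` whose body is VERBATIM referee lane 3's
  `Prop52Concrete` (HOME/ns-claims-ref-3/retype-Shahmurov2026-typed.lean sha16 `ddb87ea3682d2a4a`, l.38–45;
  that file is referee scratch, not a tree module — condition (a)).
* `Shahmurov2026.exists_concrete_saturating` — `∃ K g h, IsSO4Radial g ∧ IsSO4Radial h ∧ (∀ x, 0 ≤ h x) ∧
  K.pairClass.A g h = 1 ∧ 0 < K.pairClass.J g h` (the right-hand side of lane 3's `not_prop52Concrete_iff`,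
  condition (c): both the `∃` and the `¬` are stated).
* `Shahmurov2026.not_prop52Concrete_iff` (lane 3's l.83–97, re-proved) and
  **`Shahmurov2026.not_Prop52Concrete : ¬ Prop52Concrete`**.
* `Shahmurov2026.Concrete.exists_saturatingShape` — the stronger, calibration-free form: for EVERY Part I
  bookkeeping `K : TerminalBookkeeping` whose cut-off satisfies `χ ≡ 1` on the unit core `‖x‖ ≤ 1` (T p.8
  l.315–319: «`0 ≤ χ ≤ 1`, `χ ≡ 1` on `B₁^{axis}`, `supp χ ⊂ B₂^{axis}`») — any `α, β > 0`, any cylinder data —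
  the lifted class `K.pairClass` (T §5 p.14 l.695–711) contains an `SO(4)`-radial pair, `h ≥ 0`, with `𝔸 = 1`,
  `𝕁 > 0`; `exists_saturatingShape'` adds: both profiles smooth, `≥ 0`, compactly supported in the unit core.
* `Shahmurov2026.Concrete.Kcore` — a concrete bookkeeping (unit calibration, the radial bump cut-off
  `χcore = 1` on `B₁`, `tsupport χcore ⊆ closedBall 0 (3/2) ⊂ B₂`, no cylinders) used to instantiate the `∃ K`.
* `Shahmurov2026.Concrete.not_noSaturating_concreteFace` (lane 3's `NoSaturatingConcrete` body is false) and
  `step_I51_of_coreCutoff` (the typed conclusion of Step I-5.1 is inhabited for every core cut-off `K`,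
  independently of `¬ StrictBridge K`); the three abstract kills of record (`…Theorems.Shahmurov2026.not_Prop52`
  / `not_NoSaturatingProfile` / `not_Prop52Stationarity`, p464850, abstract power-law model) are re-derived
  INSIDE the lifted class as `example`s only.

## Mechanism (all inside the paper's functionals `recoveredStrain` / `visibility` / `transferG` / `transferH`)

`U[g](x) = ∫ K(x−y) g(y) dy` with `K = ∂_zΓ`, `Γ` the Newtonian kernel of `ℝ⁵`; off the origin
`K(X) = 2A⁻¹k(‖X‖²)^{−k−1}X_z` (`KK_eq`), so `K < 0` strictly below the source (`KK_neg`). Take two axial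
radial bumps of radii `1/10 < 1/5`: `gU` centred at `+½e_z`, `hU ≥ 0` centred at `−½e_z` (both `SO(4)`-radial,
smooth, supported in `‖x‖ ≤ 7/10 < 1` where every admissible `χ` equals `1`). Every point of `supp hU` lies
strictly below every point of `supp gU` (`zgap`), so on `supp hU` the recovered strain `U[gU]` is a continuous,
nonpositive function, strictly negative at the centre (`ΦU_cH_neg`, one jointly continuous compactly supported
parametric integral — the kernel singularity never meets `supp ψU × supp gU`). Hence
`J₂[gU,hU] = ∫ χ²U[gU]hU² < 0` (`transferH_neg`), `W[hU] ≥ ∫|∇hU|² > 0` (`visibility_hU_pos`), `V[gU] ≥ 0`,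
and for amplitudes `g = a·gU`, `h = b·hU` the paper's scaling laws (`visibility_constMul`, `transferG_constMul`,
`transferH_constMul_left/right`, l.787–797) give `𝔸 = a²V + βb²W`, `𝕁 = a³J₁ − αab²J₂`; `scaling_algebra`
picks `a` small and `b` to normalise: `𝔸 = 1`, `𝕁 > 0`. At such a pair (17) ∧ (18) force `𝕁 = 0` by the
print's own algebra (F16; `noSaturatingProfile_of_prop52`), so the face fails.

## What this is NOT (condition (b))
By-slot of #11; like the typed `Prop52`, the face `Prop52Concrete` carries NO saturation hypothesis (only
`𝔸 = 1`, `𝕁 = Λ > 0`), so the pair above is in the print's class only if it also maximised the endpoint quotient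
— it is not claimed to; the saturated face `Prop52Sat` (retype-Shahmurov2026-sat.lean fd39ca0763650896) is
true-vacuous; the class of #11 is unfilled gap, UNCHANGED. The kernel fact recorded is «the typed Step and its
charitable concrete face are false as typed», not «false lemma in the print's class».
WHAT THIS IS NOT: not a claim about NS regularity or blow-up; not a claim about any author beyond the typed
locator.
-/

noncomputable section

-- The summit's canonical theorem namespace repeats the summit name (single-conjunct summit).
set_option linter.dupNamespace false

namespace Summit.NavierStokesRegularity.NavierStokesRegularity.Theorems.Shahmurov2026.Concrete

open MeasureTheory Set Filter Topology Metric
open Literature.Claims.NS.Shahmurov2026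
open Literature.Analysis.PDE

/-! ### H. Headline: a saturating-shape pair in the lifted class of EVERY bookkeeping with a core cut-off -/

/-- **For every Part I bookkeeping `K` whose terminal cut-off is `≡ 1` on the unit core `B₁` (T p.8,
l.315–321: "`χ ≡ 1` on `B₁^{axis}`, `supp χ ⊂ B₂^{axis}`") — ANY calibration `α, β > 0`, any cylinder
bookkeeping — the paper's concrete lifted pair class `K.pairClass` (T §5 p.14, l.695–711) contains an
`SO(4)`-radial, smooth, compactly supported pair `(g, h)` with `h ≥ 0`, pair visibility `𝔸[g,h] = 1` and pair
transfer `𝕁[g,h] > 0`.** Witness: `g = a·gU`, `h = b·hU` (axial bumps at `±½e₄`), `a, b` from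
`scaling_algebra`. [cite: Shahmurov2026TwoPart, §5 p.14–15] -/
theorem exists_saturatingShape (K : TerminalBookkeeping) (hχ : ∀ x : E5, ‖x‖ ≤ 1 → K.χ x = 1) :
    ∃ g h : E5 → ℝ, IsSO4Radial g ∧ IsSO4Radial h ∧ (∀ x, 0 ≤ h x) ∧
      K.pairClass.A g h = 1 ∧ 0 < K.pairClass.J g h := by
  obtain ⟨a, b, -, hb, hA, hJ⟩ := scaling_algebra (J₁ := transferG K.χ gU) (visibility_nonneg K.χ gU)
    (visibility_hU_pos K.χ hχ) (transferH_neg K.χ hχ) K.α_pos K.β_pos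
  refine ⟨fun x => a * gU x, fun x => b * hU x, isSO4Radial_constMul isSO4Radial_gU a,
    isSO4Radial_constMul isSO4Radial_hU b, fun x => mul_nonneg hb.le (hU_nonneg x), ?_, ?_⟩
  · simp only [PairClass.A, TerminalBookkeeping.pairClass, liftedPairClass, visibility_constMul]
    exact hA
  · simp only [PairClass.J, TerminalBookkeeping.pairClass, liftedPairClass, transferG_constMul,
      transferH_constMul_left, transferH_constMul_right]
    exact hJ

/-- The same with the finer provenance data a referee may ask for: both profiles smooth, nonnegative and
compactly supported in the unit core. -/
theorem exists_saturatingShape' (K : TerminalBookkeeping) (hχ : ∀ x : E5, ‖x‖ ≤ 1 → K.χ x = 1) :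
    ∃ g h : E5 → ℝ, IsSO4Radial g ∧ IsSO4Radial h ∧ (∀ x, 0 ≤ g x) ∧ (∀ x, 0 ≤ h x) ∧
      ContDiff ℝ (⊤ : ℕ∞) g ∧ ContDiff ℝ (⊤ : ℕ∞) h ∧ HasCompactSupport g ∧ HasCompactSupport h ∧
      (∀ x, g x ≠ 0 → ‖x‖ ≤ 1) ∧ (∀ x, h x ≠ 0 → ‖x‖ ≤ 1) ∧
      K.pairClass.A g h = 1 ∧ 0 < K.pairClass.J g h := by
  obtain ⟨a, b, ha, hb, hA, hJ⟩ := scaling_algebra (J₁ := transferG K.χ gU) (visibility_nonneg K.χ gU)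
    (visibility_hU_pos K.χ hχ) (transferH_neg K.χ hχ) K.α_pos K.β_pos
  refine ⟨fun x => a * gU x, fun x => b * hU x, isSO4Radial_constMul isSO4Radial_gU a,
    isSO4Radial_constMul isSO4Radial_hU b, fun x => mul_nonneg ha.le (gU_nonneg x),
    fun x => mul_nonneg hb.le (hU_nonneg x), contDiff_const.mul contDiff_gU, contDiff_const.mul contDiff_hU,
    hasCompactSupport_gU.mul_left, hasCompactSupport_hU.mul_left,
    fun x hx => norm_le_one_of_gU_ne_zero (right_ne_zero_of_mul hx),
    fun x hx => norm_le_one_of_hU_ne_zero (right_ne_zero_of_mul hx), ?_, ?_⟩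
  · simp only [PairClass.A, TerminalBookkeeping.pairClass, liftedPairClass, visibility_constMul]
    exact hA
  · simp only [PairClass.J, TerminalBookkeeping.pairClass, liftedPairClass, transferG_constMul,
      transferH_constMul_left, transferH_constMul_right]
    exact hJ

/-! ### I. A concrete bookkeeping: unit calibration, the standard terminal cut-off, no cylinders -/

/-- The standard terminal cut-off of T p.8 (l.315–321), realised as the radial bump `χcore = bump 0 1 (3/2)`:
smooth, radial, `0 ≤ χcore ≤ 1`, `χcore ≡ 1` on `B₁`, `supp χcore ⊆ closedBall 0 (3/2) ⊂ B₂`.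
[cite: Shahmurov2026TwoPart, §2.1 p.8] -/
def χcore : E5 → ℝ := bump 0 1 (3 / 2)

/-- `χcore = 1` on the unit core `B₁`. -/
theorem χcore_eq_one {x : E5} (hx : ‖x‖ ≤ 1) : χcore x = 1 :=
  bump_eq_one zero_le_one (by norm_num) (by simpa using hx)

/-- `χcore = 0` off `ball 0 (3/2)`. -/
theorem χcore_eq_zero {x : E5} (hx : 3 / 2 ≤ ‖x‖) : χcore x = 0 :=
  bump_eq_zero zero_le_one (by norm_num) (by simpa using hx)

/-- `0 ≤ χcore`. -/
theorem χcore_nonneg (x : E5) : 0 ≤ χcore x := bump_nonneg _ _ _ _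

/-- `χcore ≤ 1`. -/
theorem χcore_le_one (x : E5) : χcore x ≤ 1 := bump_le_one _ _ _ _

/-- `χcore` is smooth. -/
theorem contDiff_χcore {n : ℕ∞} : ContDiff ℝ n χcore := contDiff_bump _ _ _

/-- `supp χcore ⊂ B₂` (T p.8 l.318). -/
theorem tsupport_χcore_subset : tsupport χcore ⊆ ball (0 : E5) 2 :=
  (tsupport_bump_subset zero_le_one (by norm_num)).trans (closedBall_subset_ball (by norm_num))

/-- `χcore` is radial, hence `SO(4)`-radial. -/
theorem isSO4Radial_χcore : IsSO4Radial χcore := by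
  have h := isSO4Radial_bump 0 1 (3 / 2)
  rwa [zero_smul] at h

/-- A Part I bookkeeping with unit calibration `α = β = 1`, the standard cut-off `χcore` and NO terminal
cylinders (the cylinder fields are irrelevant to `K.pairClass`, which depends on `α, β, χ` only). -/
def Kcore : TerminalBookkeeping where
  α := 1
  β := 1
  α_pos := one_pos
  β_pos := one_pos
  χ := χcore
  Cyl := PEmpty
  compactCritical := fun _ => False
  firstThreshold := fun _ => False
  A := fun _ => 0
  J := fun _ => 0
  Edir := fun _ => 0
  Bend := fun _ => 0

/-- The cut-off of `Kcore` is `≡ 1` on the unit core. -/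
theorem Kcore_chi_eq_one (x : E5) (hx : ‖x‖ ≤ 1) : Kcore.χ x = 1 := χcore_eq_one hx

/-! ### J. Consequences for the typed Steps -/

/-- **«No saturating profile» fails at the charitable concrete grain** (referee lane 3's
`NoSaturatingConcrete`, verbatim body): the contradiction target of Theorem 5.4's printed proof (p.15,
l.860–866) is NOT absurd — the lifted class does carry pairs with `𝔸 = 1`, `𝕁 = Λ > 0`.
[cite: Shahmurov2026TwoPart, Thm 5.4 proof p.15] -/
theorem not_noSaturating_concreteFace :
    ¬ (∀ (K : TerminalBookkeeping) (g h : E5 → ℝ) (Λ : ℝ),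
        IsSO4Radial g → IsSO4Radial h → (∀ x, 0 ≤ h x) →
        K.pairClass.A g h = 1 → K.pairClass.J g h = Λ → 0 < Λ → False) := by
  intro hno
  obtain ⟨g, h, hg, hh, hpos, hA, hJ⟩ := exists_saturatingShape Kcore Kcore_chi_eq_one
  exact hno Kcore g h _ hg hh hpos hA rfl hJ

/-- The typed conclusion of **Step I-5.1** (`Step_I51 K`: an `SO(4)`-radial pair, `h ≥ 0`, `𝔸 = 1`,
`𝕁 = Λ_* > 0` in `K.pairClass`) is INHABITED for every bookkeeping with a core cut-off — independently of
the hypothesis `¬ StrictBridge K`; in particular `Step_I51 K` holds for all such `K`.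
[cite: Shahmurov2026TwoPart, Prop 5.1 p.14] -/
theorem step_I51_of_coreCutoff (K : TerminalBookkeeping) (hχ : ∀ x : E5, ‖x‖ ≤ 1 → K.χ x = 1) :
    Step_I51 K := fun _ => by
  obtain ⟨g, h, hg, hh, hpos, hA, hJ⟩ := exists_saturatingShape K hχ
  exact ⟨g, h, _, hg, hh, hpos, hA, rfl, hJ⟩

/-! Re-derivations INSIDE the paper's lifted class of the three abstract kills already in the tree
(`…Theorems.Shahmurov2026.not_NoSaturatingProfile` / `not_Prop52` / `not_Prop52Stationarity`, p464850, abstract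
power-law model) — stated as `example`s only (the named theorems of record stand; no duplicate decls). -/

example : ¬ NoSaturatingProfile := fun hno => by
  obtain ⟨g, h, -, -, -, hA, hJ⟩ := exists_saturatingShape Kcore Kcore_chi_eq_one
  exact hno Kcore.pairClass g h _ hA rfl hJ

example : ¬ Prop52 := fun h52 => by
  obtain ⟨g, h, -, -, -, hA, hJ⟩ := exists_saturatingShape Kcore Kcore_chi_eq_one
  exact noSaturatingProfile_of_prop52 h52 Kcore.pairClass g h _ hA rfl hJ

example : ¬ Prop52Stationarity := fun h => by
  obtain ⟨g, h', -, -, -, hA, hJ⟩ := exists_saturatingShape Kcore Kcore_chi_eq_one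
  exact noSaturatingProfile_of_prop52 (prop52_of_stationarity h) Kcore.pairClass g h' _ hA rfl hJ

end Summit.NavierStokesRegularity.NavierStokesRegularity.Theorems.Shahmurov2026.Concrete

namespace Summit.NavierStokesRegularity.NavierStokesRegularity.Theorems.Shahmurov2026

open Literature.Claims.NS.Shahmurov2026

/-! ### K. The by-slot record: referee lane 3's charitable face `Prop52Concrete` and its negation -/

/-- **The charitable concrete face of Proposition 5.2 — BY-SLOT of row #11, records-grade.** The body below
is VERBATIM referee lane 3's `Prop52Concrete` (HOME/ns-claims-ref-3/retype-Shahmurov2026-typed.lean, sha16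
`ddb87ea3682d2a4a`, l.38–45; namespace `Literature.Claims.NS.RefereeScratch.Shahmurov2026Typed`, NOT a tree
decl — hence carried here as a local `def`, chair RULINGS 2026-08-27T08:12Z (1)(a)): Prop 5.2 (17)–(18)
restricted to the paper's concrete lifted class `K.pairClass` with every provenance predicate Step I-5.1
delivers (`SO(4)`-radial `g, h`, `h ≥ 0`). RECORD (chair (1)(b), ref-3 g5 2026-08-27T08:09:13Z): by-slot of
#11 only; like the typed `Prop52`, this face carries NO saturation hypothesis (only `𝔸 = 1`, `𝕁 = Λ > 0`) and is
therefore NOT the print's class («the strong endpoint profile from Proposition 5.1», which also maximises the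
endpoint quotient); the saturated face `Prop52Sat` (retype-Shahmurov2026-sat.lean fd39ca0763650896) is
true-vacuous; the class of record of #11 is UNCHANGED — unfilled gap at Prop 5.2 p.14–15 (stationarity premise /
interface with Prop 5.1), load-bearing Thm 5.4 p.15; token `Literature.Claims.NS.Shahmurov2026.Prop52`, locator
and totals untouched. [cite: Shahmurov2026TwoPart, Prop 5.2 p.14–15] -/
def Prop52Concrete : Prop :=
  ∀ (K : TerminalBookkeeping) (g h : E5 → ℝ) (Λ : ℝ),
    IsSO4Radial g → IsSO4Radial h → (∀ x, 0 ≤ h x) →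
    K.pairClass.A g h = 1 → K.pairClass.J g h = Λ → 0 < Λ →
      3 * K.pairClass.J₁ g - K.pairClass.α * K.pairClass.J₂ g h = 2 * Λ * K.pairClass.V g ∧
      -(K.pairClass.α * K.pairClass.J₂ g h) = Λ * (K.pairClass.β * K.pairClass.W h)

/-- **A concrete saturating-shape pair exists** (the right-hand side of referee lane 3's
`not_prop52Concrete_iff`, l.83–97 of ddb87ea3682d2a4a): a Part I bookkeeping `K` (unit calibration, the
standard terminal cut-off `χ ≡ 1` on `B₁`, `supp χ ⊂ B₂`) and an `SO(4)`-radial pair `(g, h)`, `h ≥ 0`, in its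
lifted class with `𝔸[g,h] = 1` and `𝕁[g,h] > 0`. In fact EVERY bookkeeping whose cut-off is `≡ 1` on the unit
core carries such a pair (`Concrete.exists_saturatingShape`). [cite: Shahmurov2026TwoPart, §5 p.14–15] -/
theorem exists_concrete_saturating :
    ∃ (K : TerminalBookkeeping) (g h : E5 → ℝ),
      IsSO4Radial g ∧ IsSO4Radial h ∧ (∀ x, 0 ≤ h x) ∧
      K.pairClass.A g h = 1 ∧ 0 < K.pairClass.J g h :=
  ⟨Concrete.Kcore, Concrete.exists_saturatingShape Concrete.Kcore Concrete.Kcore_chi_eq_one⟩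

/-- Referee lane 3's `not_prop52Concrete_iff` (l.83–97 of ddb87ea3682d2a4a), re-proved here so that the record
is self-contained: a countermodel to the charitable face is EXACTLY a concrete lifted pair with `𝔸 = 1`,
`𝕁 > 0` (the print's own F16 algebra: (17) ∧ (18) with `𝔸 = 1`, `𝕁 = Λ` force `Λ = 0`).
[cite: Shahmurov2026TwoPart, Prop 5.2 p.14–15] -/
theorem not_prop52Concrete_iff :
    ¬ Prop52Concrete ↔ ∃ (K : TerminalBookkeeping) (g h : E5 → ℝ),
      IsSO4Radial g ∧ IsSO4Radial h ∧ (∀ x, 0 ≤ h x) ∧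
      K.pairClass.A g h = 1 ∧ 0 < K.pairClass.J g h := by
  constructor
  · intro hne
    by_contra hnex
    refine hne fun K g h Λ hg hh hpos hA hJ hΛ => ?_
    exact (hnex ⟨K, g, h, hg, hh, hpos, hA, hJ ▸ hΛ⟩).elim
  · rintro ⟨K, g, h, hg, hh, hpos, hA, hJ⟩ h52
    obtain ⟨e1, e2⟩ := h52 K g h _ hg hh hpos hA rfl hJ
    have hJ' := hJ
    simp only [PairClass.J, PairClass.A] at hA hJ' e1 e2
    have hzero : K.pairClass.J₁ g - K.pairClass.α * K.pairClass.J₂ g h = 0 := by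
      linear_combination e1 + 2 * e2 + 2 * (K.pairClass.J₁ g - K.pairClass.α * K.pairClass.J₂ g h) * hA
    exact absurd hzero hJ'.ne'

/-- **BY-SLOT RECORD for row #11: the charitable concrete face `Prop52Concrete` is false as typed** — the
paper's own lifted pair class (T §5 p.14, l.695–711: `J₁ = ∫χ²g²U[g]`, `J₂ = ∫χ²U[g]h²`, `V = ∫χ²|∇g|² +
∫|∇χ|²g²`, `W` likewise, `U[g] = ∂_z(−Δ)⁻¹g` on `ℝ⁵`) contains, for the standard terminal cut-off and unit
calibration, an `SO(4)`-radial pair with `h ≥ 0`, `𝔸 = 1`, `𝕁 > 0`, at which (17) ∧ (18) cannot both hold.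
Classification (records-grade, NOT a verdict change): the kernel fact is «the typed Step `Prop52` and its
charitable face `Prop52Concrete` are false as typed»; it is NOT «false lemma in the print's class» — the print's
Prop 5.2 speaks of the SATURATING profile of Prop 5.1, a hypothesis neither face carries (`Prop52Sat`
true-vacuous); class of #11 stays unfilled gap @ `Prop52`. [cite: Shahmurov2026TwoPart, Prop 5.2 p.14–15] -/
theorem not_Prop52Concrete : ¬ Prop52Concrete :=
  not_prop52Concrete_iff.2 exists_concrete_saturating

end Summit.NavierStokesRegularity.NavierStokesRegularity.Theorems.Shahmurov2026

end

-- WHAT THIS IS NOT: not a claim about NS regularity or blow-up; not a claim about any author beyond the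
-- typed locator.
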